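import Summits.BirchSwinnertonDyer.Rank1Residual.GaloisImage.IsogenySurjTransport
import Summits.BirchSwinnertonDyer.Rank1Residual.X4.KimConjectureIsogenyOptimal
import Summits.BirchSwinnertonDyer.Rank1Residual.Additive.GordManinConstant
import Summits.BirchSwinnertonDyer.Rank1Residual.Additive.GordIsogenyInvariance
import Summits.BirchSwinnertonDyer.Rank1Residual.X12.InertCoreEveryCurve
import Literature.NumberTheory.EllipticCurves.AnalyticRankModularityProofs
import HarnessLib

/-!
# X4 ∧ `r_an = 0` at `p ≥ 5`: Kim's Conjecture 1.10 AT THE OPTIMAL MEMBER decides `BSD(E,p)` for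
# EVERY member; at `p ≥ 11` the MANIN♭ residue is LOCATED on Edixhoven's exception
# (cell `b2b-bsdres`, seat additive-p4, GEN 18, line V33 part B; CLASS-CLOSURE E3 isogeny transport)

HONEST FRAMING (cell `b2b-bsdres`, run/shared/lean/b2b/bsd-rank1-residual/, verbatim in every
file): the goal of the cell is to DELETE the COMBINATION-SHAPED residual classes of the
Birch–Swinnerton-Dyer formula for ALL analytic-rank `≤ 1` elliptic curves over `ℚ` — "full BSD
formula for every rank `≤ 1` curve in class `C`" assembled STRICTLY from published theorems — so
that the rank-`≤ 1` remainder becomes exactly the CONSTRUCTION-SHAPED classes, which are TYPED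
(missing-input `Prop`s), NOT attempted. This is not "finishing BSD". Seat `additive-p4`
(CLASS-OWNERS row "X3♯/X4♯ direct"): research route on the CONSTRUCTION-SHAPED class X4; theorems
only — no definition, no named fact minted (Kim's two one-sided facts F3 / F4c with their reading
flags, Cassels' isogeny invariance, Edixhoven 1991 Thm. 3 in its two print-faithful transcriptions,
Gross–Zagier–Kolyvagin and the Modularity theorem enter as HYPOTHESES); X4 stays
CONSTRUCTION-SHAPED; no label or mark moves; nothing is booked.

## What this file proves

GEN 17's END STATE `X4/KimConjectureIsogenyOptimal.lean` §3 said: at `p ≥ 5`, "`MissingPPartAt`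
on every X4 ∧ `r_an = 0` ∧ surj pair" ⟺ "Kim's Conjecture 1.10 on every OPTIMAL conductor-level
datum with `p ∤ c`" ∧ "`MissingPPartAt` on the pairs with NO isogenous X4 ∧ surj curve carrying such
a datum" (MANIN♭ proper). Two inputs sharpen it:

* Part A (`GaloisImage/IsogenySurjTransport.lean`, this generation): on class X4 (`E[p]`
  irreducible) `Surj` is a CLASS INVARIANT, so "isogenous X4 ∧ surj curve" = "isogenous curve".
* Edixhoven 1991 Thm. 3 as placed by additive-p2 (`Additive/GordManinConstant.lean`,
  `Addv.typeGOrd_and_le_four_of_dvd_maninConstant`): at an additive `p ≥ 11`, `p ∣ c` for the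
  STRONG (lattice-optimal, conductor-level) datum forces `TypeGOrd W p ∧ ord_p Δ_min ≤ 4` —
  (G)-ordinary of Kodaira type II / III / IV. The Kodaira bit is not a class invariant (II ↔ II*
  inside a class), but the semistability defect is (`semistabilityIndex_eq_of_isIsogenous_of_typeG_of_addv`),
  and types II/III/IV have defect `6/4/3 ≠ 2`; so on the CLASS the exception reads
  **`TypeGOrd W p ∧ semistabilityIndex W p ≠ 2`** = the (G-ord) cell of defect `3, 4, 6`
  (additive-p2's `SubGordHigher` rows; I₀* = defect `2`, the (M) rows, the potentially
  supersingular and (T′) rows are all OUTSIDE).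
* The strong member exists in every class from Modularity alone (x1b's
  `X12.exists_isIsogenous_optimal`).

Whence (namespace `Summit.BirchSwinnertonDyer.Rank1Residual.X4`):

* §1 (every `p ≥ 5`) `bsdp_iff_kimTamagawaDefectAt_isogenous_optimal_of_kimFacts_of_five_le`: for ANY
  member `W` (X4, `r_an = 0`, surj) and any isogenous globally minimal `W₀` with an optimal
  conductor-level datum `D₀`, `p ∤ c(D₀)`: **`BSD(W,p) ⟺ X4.KimTamagawaDefectAt W₀ p D₀.f`** —
  Conj. 1.10 at the optimal member decides the whole Cremona class; `…missingPPartAt_iff…` twin;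
  `x4RankZero_fiveLe_iff_kimTamagawaDefect_optimal_of_kimFacts'` — GEN 17's END STATE with clause
  (ii) freed of its `ClassX4 W₀ p ∧ Surj W₀ p` conjuncts.
* §2 (`p ≥ 11`) `semistabilityIndex_ne_two_of_padicValInt_le_four` (arithmetic);
  `edixhovenException_of_isIsogenous_optimal` (`p ∣ c(D₀)` at the strong member ⟹
  `TypeGOrd W p ∧ semistabilityIndex W p ≠ 2` for every member `W`);
  **`exists_isIsogenous_optimal_not_dvd_maninConstant_of_not_exception`** — off the exception every
  X4-type (indeed every additive) class HAS a strong member with `p ∤ c`: MANIN♭ proper is EMPTY there;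
  **`bsdp_iff_kimTamagawaDefectAt_optimal_of_not_exception`** (per pair: X4 ∧ `r_an = 0` ∧ surj ∧
  `p ≥ 11` off the exception ⟹ for every optimal isogenous `(W₀, D₀)`: `p ∤ c(D₀)` and
  `BSD(W,p) ⟺` Conj. 1.10 at `(W₀, p, D₀.f)`); `exists_optimal_bsdp_iff_kimTamagawaDefectAt_of_not_exception`.
* §3 (`p ≥ 11`) **`x4RankZero_elevenLe_iff_kimTamagawaDefect_optimal_of_edixhoven`** — the END STATE:
  "`MissingPPartAt` on every X4 ∧ `r_an = 0` ∧ surj ∧ `p ≥ 11` pair" ⟺ "Conj. 1.10 on every optimal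
  conductor-level datum with `p ∤ c` (of such curves)" ∧ "`MissingPPartAt` on the EXCEPTION pairs
  (`TypeGOrd W p ∧ semistabilityIndex W p ≠ 2`) none of whose isogenous strong data has `p ∤ c`".
  At `p ≥ 11` the MANIN♭ residue of the X4 ∧ `r = 0` map is thus CONFINED to (G-ord) ∩ defect
  `{3,4,6}` — where print allows `p ∣ c` once (Edixhoven) — and is EMPTY on (M), I₀*, (G-ss), (T′).

Census note (EVIDENCE, not used): every window / sweep row has Cremona-optimal `c = 1`
(MANIN = 0 in census V22); the content here is class-level, beyond any table. `p ∈ {5, 7}` keep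
GEN 17's form (Edixhoven needs `p > 7`).

References: C.-H. Kim, Amer. J. Math. 148 (2026) Thm. 1.9 (6), Conj. 1.10 [Kim2022StructureSelmer];
B. Edixhoven, Progr. Math. 89 (1991) Thm. 3 [EdixhovenManin1991]; J. W. S. Cassels, J. reine angew.
Math. 217 (1965) [Cassels1965ArithmeticVIII]; R. L. Miller, LMS J. Comput. Math. 14 (2011) Def. 1.1
[Miller2011LMS]; H. Pasten 2024 §2 / BCDT 2001 Thm. A (optimal quotient) [PastenShimura2024]
[BCDTJAMS2001]; J. H. Silverman, *ATAEC* IV Table 4.1 [SilvermanATAEC1994]; CLASS-CLOSURE-PLAN.md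
§1 item 5 (E3), §3.1/§3.2.
-/

noncomputable section

open scoped Classical MatrixGroups ModularForm

open Complex CongruenceSubgroup WeierstrassCurve Literature.NumberTheory.EllipticCurves
  Literature.NumberTheory.EllipticCurves.ModularForms
  Literature.NumberTheory.EllipticCurves.Rank1Residual
  Literature.NumberTheory.EllipticCurves.Rank1Residual.Typed
  Summit.BirchSwinnertonDyer.Rank1Residual.Additive

namespace Summit.BirchSwinnertonDyer.Rank1Residual.X4

/-! ### §1 Conj. 1.10 at the optimal member decides every member (`p ≥ 5`) -/

section ClassTransport

variable (W W₀ : WeierstrassCurve ℚ) [W.IsElliptic] [W.IsGloballyMinimal] [W₀.IsElliptic]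
  [W₀.IsGloballyMinimal] (p : ℕ) [Fact p.Prime]

/-- **`BSD(W,p) ⟺` Kim's Conjecture 1.10 at an OPTIMAL ISOGENOUS member** (`p ≥ 5`, analytic rank
`0`): for `W` of class X4 with `ρ̄_{W,p}` onto and `W₀ ∼ W` globally minimal carrying an optimal
conductor-level datum `D₀` (`Λ_{E₀} = c·Λ_f`) with `p ∤ c`: `BSD(W,p) ⟺ X4.KimTamagawaDefectAt W₀ p D₀.f`.
`Surj W₀ p` is NOT a hypothesis: it is transported from `W` (part A,
`GaloisImage.surj_iff_of_isIsogenous_of_classX4`); `BSD(·,p)` is transported by Cassels.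
[cite: Kim2022StructureSelmer, Thm. 1.9 (6) and Conj. 1.10 (PDF p. 8)] [cite: Cassels1965ArithmeticVIII]
[cite: Miller2011LMS, §1 and Def. 1.1] -/
theorem bsdp_iff_kimTamagawaDefectAt_isogenous_optimal_of_kimFacts_of_five_le
    (hKimk : Kim2026.rankZero_le_padicValNat_sha_of_kuriharaNumber_ne_zero)
    (hE67c : Kim2026.rankZero_padicValNat_sha_add_le_of_forall_pow_dvd_kuriharaNumber_cyclicLevel)
    (hCassels : bsdRHS_eq_of_isIsogenous)
    (hGZK : rank_eq_analyticRank_of_analyticRank_le_one) (hmod : hasEntireLFunction_rat)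
    (hp : 5 ≤ p) (hr : W.analyticRank = 0) (hX : ClassX4 W p) (hsurj : Surj W p)
    (hiso : IsIsogenous W₀ W) {N₀ : ℕ} [NeZero N₀] (D₀ : ModularParametrizationData W₀ N₀)
    (hN₀ : W₀.conductorNorm ℤ = N₀)
    (hopt₀ : ∀ z ∈ D₀.L.lattice, ∃ w ∈ periodLattice D₀.f, z = D₀.c * w)
    (hc₀ : ¬ (p : ℤ) ∣ D₀.maninConstant) :
    BSDp W p ↔ KimTamagawaDefectAt W₀ p D₀.f := by
  have hr₀ : W₀.analyticRank = 0 := by rw [analyticRank_eq_of_isIsogenous' hiso, hr]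
  have hs₀ : Surj W₀ p :=
    (GaloisImage.surj_iff_of_isIsogenous_of_classX4 hiso.symm_of_isElliptic hX).mp hsurj
  rw [← bsdp_iff_kimTamagawaDefectAt_of_optimal_of_kimFacts_of_five_le W₀ p hKimk hE67c hGZK hmod hp
    hr₀ hs₀ D₀ hN₀ hopt₀ hc₀]
  exact Additive.TwistComparison.bsdp_iff_bsdp_of_isIsogenous W W₀ p hCassels hGZK hmod
    hiso.symm_of_isElliptic (by rw [hr]; exact zero_le_one)

/-- **`Typed.MissingPPartAt W p ⟺` Conj. 1.10 at an optimal isogenous member** (same hypotheses;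
`MissingPPartAt ⟺ BSDp` in analytic rank `≤ 1` by GZK). [cite: Kim2022StructureSelmer, Conj. 1.10 (PDF p. 8)]
[cite: Cassels1965ArithmeticVIII] [cite: Miller2011LMS, Def. 1.1] -/
theorem missingPPartAt_iff_kimTamagawaDefectAt_isogenous_optimal_of_kimFacts_of_five_le
    (hKimk : Kim2026.rankZero_le_padicValNat_sha_of_kuriharaNumber_ne_zero)
    (hE67c : Kim2026.rankZero_padicValNat_sha_add_le_of_forall_pow_dvd_kuriharaNumber_cyclicLevel)
    (hCassels : bsdRHS_eq_of_isIsogenous)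
    (hGZK : rank_eq_analyticRank_of_analyticRank_le_one) (hmod : hasEntireLFunction_rat)
    (hp : 5 ≤ p) (hr : W.analyticRank = 0) (hX : ClassX4 W p) (hsurj : Surj W p)
    (hiso : IsIsogenous W₀ W) {N₀ : ℕ} [NeZero N₀] (D₀ : ModularParametrizationData W₀ N₀)
    (hN₀ : W₀.conductorNorm ℤ = N₀)
    (hopt₀ : ∀ z ∈ D₀.L.lattice, ∃ w ∈ periodLattice D₀.f, z = D₀.c * w)
    (hc₀ : ¬ (p : ℤ) ∣ D₀.maninConstant) :
    MissingPPartAt W p ↔ KimTamagawaDefectAt W₀ p D₀.f := by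
  have hr1 : W.analyticRank ≤ 1 := by rw [hr]; exact zero_le_one
  haveI : Finite W.sha := (hGZK W hr1).2
  rw [← bsdp_iff_kimTamagawaDefectAt_isogenous_optimal_of_kimFacts_of_five_le W W₀ p hKimk hE67c
    hCassels hGZK hmod hp hr hX hsurj hiso D₀ hN₀ hopt₀ hc₀]
  exact ⟨bsdp_of_missingPPartAt W p hGZK hr1, missingPPartAt_of_bsdp W p⟩

end ClassTransport

/-- **GEN 17's END STATE with clause (ii) freed of `ClassX4 W₀ p ∧ Surj W₀ p`** (both transported
along the class by part A): at `p ≥ 5`, "`MissingPPartAt` on every X4 ∧ `r_an = 0` ∧ surj pair" ⟺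
"Conj. 1.10 on every optimal conductor-level datum with `p ∤ c`" ∧ "`MissingPPartAt` on the pairs NONE
of whose isogenous globally minimal curves carries an optimal conductor-level datum with `p ∤ c`".
[cite: Kim2022StructureSelmer, Thm. 1.9 (6) and Conj. 1.10 (PDF p. 8)] [cite: Cassels1965ArithmeticVIII]
[cite: Miller2011LMS, §1 and Def. 1.1] -/
theorem x4RankZero_fiveLe_iff_kimTamagawaDefect_optimal_of_kimFacts'
    (hKimk : Kim2026.rankZero_le_padicValNat_sha_of_kuriharaNumber_ne_zero)
    (hE67c : Kim2026.rankZero_padicValNat_sha_add_le_of_forall_pow_dvd_kuriharaNumber_cyclicLevel)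
    (hCassels : bsdRHS_eq_of_isIsogenous)
    (hGZK : rank_eq_analyticRank_of_analyticRank_le_one) (hmod : hasEntireLFunction_rat) :
    (∀ (W : WeierstrassCurve ℚ) [W.IsElliptic] [W.IsGloballyMinimal] (p : ℕ) [Fact p.Prime],
        5 ≤ p → W.analyticRank = 0 → ClassX4 W p → Surj W p → MissingPPartAt W p) ↔
      (∀ (W : WeierstrassCurve ℚ) [W.IsElliptic] [W.IsGloballyMinimal] (p : ℕ) [Fact p.Prime],
          5 ≤ p → W.analyticRank = 0 → ClassX4 W p → Surj W p →
          ∀ {N : ℕ} [NeZero N] (D : ModularParametrizationData W N), W.conductorNorm ℤ = N →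
          (∀ z ∈ D.L.lattice, ∃ w ∈ periodLattice D.f, z = D.c * w) → ¬ (p : ℤ) ∣ D.maninConstant →
          KimTamagawaDefectAt W p D.f) ∧
      (∀ (W : WeierstrassCurve ℚ) [W.IsElliptic] [W.IsGloballyMinimal] (p : ℕ) [Fact p.Prime],
          5 ≤ p → W.analyticRank = 0 → ClassX4 W p → Surj W p →
          (∀ (W₀ : WeierstrassCurve ℚ) [W₀.IsElliptic] [W₀.IsGloballyMinimal], IsIsogenous W₀ W →
            ∀ (N₀ : ℕ) [NeZero N₀] (D₀ : ModularParametrizationData W₀ N₀),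
              W₀.conductorNorm ℤ ≠ N₀ ∨ (¬ ∀ z ∈ D₀.L.lattice, ∃ w ∈ periodLattice D₀.f, z = D₀.c * w) ∨
              (p : ℤ) ∣ D₀.maninConstant) →
          MissingPPartAt W p) := by
  rw [x4RankZero_fiveLe_iff_kimTamagawaDefect_optimal_of_kimFacts hKimk hE67c hCassels hGZK hmod]
  refine and_congr_right fun _ ↦ ?_
  refine forall₅_congr fun W _ _ p _ ↦ ?_
  refine forall₄_congr fun hp hr hX hs ↦ ?_
  refine imp_congr_left ?_
  refine forall₃_congr fun W₀ _ _ ↦ ⟨fun h hiso N₀ _ D₀ ↦ ?_, fun h hiso _ _ N₀ _ D₀ ↦ h hiso N₀ D₀⟩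
  have hXs := (GaloisImage.classX4_and_surj_iff_of_isIsogenous (p := p) hiso).mpr ⟨hX, hs⟩
  exact h hiso hXs.1 hXs.2 N₀ D₀

/-! ### §2 At `p ≥ 11` the MANIN♭ residue lies on Edixhoven's exception -/

section Edixhoven

variable {W W₀ : WeierstrassCurve ℚ} [W.IsElliptic] [W.IsGloballyMinimal] [W₀.IsElliptic]
  [W₀.IsGloballyMinimal] {p : ℕ} [hp : Fact p.Prime]

omit [W₀.IsElliptic] hp in
/-- Kodaira types II, III, IV (`ord_p Δ_min = 2, 3, 4`; and the vacuous `0, 1`) have semistability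
defect `12 / gcd(12, ord_p Δ_min) ≠ 2` (defects `6, 4, 3`; `1, 12`). [cite: SilvermanATAEC1994, IV Table 4.1 (PDF p. 365)] -/
theorem semistabilityIndex_ne_two_of_padicValInt_le_four
    (hv : padicValInt p W₀.minimalDiscriminantInt ≤ 4) : semistabilityIndex W₀ p ≠ 2 := by
  unfold semistabilityIndex
  generalize hv' : padicValInt p W₀.minimalDiscriminantInt = v at hv
  interval_cases v <;> decide

omit hp in
/-- A prime `> 7` is `≥ 5` and `≠ 2` (bookkeeping). [folklore] -/
theorem five_le_and_ne_two_of_seven_lt (hp7 : 7 < p) : 5 ≤ p ∧ p ≠ 2 := by omega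

/-- **Edixhoven's exception, read on the CLASS**: if the strong member `W₀` (optimal conductor-level
datum `D₀`) of the class of `W` has `p ∣ c(D₀)` at an additive `p ≥ 11`, then EVERY member `W` is
(G)-ordinary at `p` with semistability defect `≠ 2` (Edixhoven 1991 Thm. 3 ⟹ `TypeGOrd W₀ p ∧
ord_p Δ_min(W₀) ≤ 4`; (G-ord) and the defect are class invariants on the additive locus).
[cite: EdixhovenManin1991, Thm. 3] [cite: SilvermanATAEC1994, IV Table 4.1 (PDF p. 365)] -/
theorem edixhovenException_of_isIsogenous_optimal
    (hEdx : edixhoven_not_dvd_maninConstant_of_not_potentiallyGoodOrdinary)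
    (hEdxK : edixhoven_not_dvd_maninConstant_of_kodairaSymbol_ne)
    (hp7 : 7 < p) (hadd₀ : Addv W₀ p) (hiso : IsIsogenous W₀ W)
    [NeZero (W₀.conductorNorm ℤ)] (D₀ : ModularParametrizationData W₀ (W₀.conductorNorm ℤ))
    (hopt₀ : ∀ z ∈ D₀.L.lattice, ∃ w ∈ periodLattice D₀.f, z = D₀.c * w)
    (hdvd : (p : ℤ) ∣ D₀.maninConstant) :
    TypeGOrd W p ∧ semistabilityIndex W p ≠ 2 := by
  obtain ⟨hG₀, hv₀⟩ :=
    Addv.typeGOrd_and_le_four_of_dvd_maninConstant W₀ p hEdx hEdxK D₀ hopt₀ hp7 hadd₀ hdvd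
  have hp2 : p ≠ 2 := (five_le_and_ne_two_of_seven_lt hp7).2
  refine ⟨hG₀.of_isIsogenous hp2 hadd₀ hiso, ?_⟩
  rw [semistabilityIndex_eq_of_isIsogenous_of_typeG_of_addv hp2 hadd₀ hG₀.typeG hiso]
  exact semistabilityIndex_ne_two_of_padicValInt_le_four hv₀

/-- **`p ∤ c` for every optimal isogenous datum, OFF the exception** (contrapositive form used by the
consumers): `W` additive at `p ≥ 11` with `¬ (TypeGOrd W p ∧ semistabilityIndex W p ≠ 2)`, `W₀ ∼ W`
with an optimal conductor-level datum `D₀` ⟹ `p ∤ c(D₀)`. [cite: EdixhovenManin1991, Thm. 3] -/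
theorem not_dvd_maninConstant_isogenous_optimal_of_not_exception
    (hEdx : edixhoven_not_dvd_maninConstant_of_not_potentiallyGoodOrdinary)
    (hEdxK : edixhoven_not_dvd_maninConstant_of_kodairaSymbol_ne)
    (hp7 : 7 < p) (hadd : Addv W p) (hexc : ¬ (TypeGOrd W p ∧ semistabilityIndex W p ≠ 2))
    (hiso : IsIsogenous W₀ W) {N₀ : ℕ} [NeZero N₀] (D₀ : ModularParametrizationData W₀ N₀)
    (hN₀ : W₀.conductorNorm ℤ = N₀)
    (hopt₀ : ∀ z ∈ D₀.L.lattice, ∃ w ∈ periodLattice D₀.f, z = D₀.c * w) :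
    ¬ (p : ℤ) ∣ D₀.maninConstant := by
  intro hdvd
  subst hN₀
  have hadd₀ : Addv W₀ p := (X2.addv_iff_of_isIsogenous (p := p) hiso).mpr hadd
  exact hexc (edixhovenException_of_isIsogenous_optimal hEdx hEdxK hp7 hadd₀ hiso D₀ hopt₀ hdvd)

variable (W p)

/-- **Off the exception, MANIN♭ proper is EMPTY at `p ≥ 11`**: every curve additive at `p ≥ 11` with
`¬ (TypeGOrd W p ∧ semistabilityIndex W p ≠ 2)` — the (M) rows, the I₀* (defect `2`) rows, the
potentially supersingular and (T′) rows — is `ℚ`-isogenous to a globally minimal curve `W₀` of the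
same conductor carrying an OPTIMAL conductor-level datum `D₀` with `p ∤ c(D₀)` (Modularity ⟹ the
strong member exists, `X12.exists_isIsogenous_optimal`; Edixhoven ⟹ `p ∤ c`).
[cite: EdixhovenManin1991, Thm. 3] [cite: BCDTJAMS2001, Thm. A] [cite: PastenShimura2024, §2 p. 12] -/
theorem exists_isIsogenous_optimal_not_dvd_maninConstant_of_not_exception
    (hnf : exists_isNewformOf)
    (hEdx : edixhoven_not_dvd_maninConstant_of_not_potentiallyGoodOrdinary)
    (hEdxK : edixhoven_not_dvd_maninConstant_of_kodairaSymbol_ne)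
    (hp7 : 7 < p) (hadd : Addv W p) (hexc : ¬ (TypeGOrd W p ∧ semistabilityIndex W p ≠ 2)) :
    ∃ (W₀ : WeierstrassCurve ℚ) (_ : W₀.IsElliptic) (_ : W₀.IsGloballyMinimal)
      (_ : NeZero (W₀.conductorNorm ℤ)) (D₀ : ModularParametrizationData W₀ (W₀.conductorNorm ℤ)),
      IsIsogenous W₀ W ∧ W₀.conductorNorm ℤ = W.conductorNorm ℤ ∧
        (∀ z ∈ D₀.L.lattice, ∃ w ∈ periodLattice D₀.f, z = D₀.c * w) ∧
        ¬ (p : ℤ) ∣ D₀.maninConstant := by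
  obtain ⟨W₀, hE₀, hM₀, hNz₀, D₀, hiso, hN, hopt₀⟩ := X12.exists_isIsogenous_optimal hnf W
  refine ⟨W₀, hE₀, hM₀, hNz₀, D₀, hiso.symm_of_isElliptic, hN, hopt₀, ?_⟩
  exact not_dvd_maninConstant_isogenous_optimal_of_not_exception hEdx hEdxK hp7 hadd hexc
    hiso.symm_of_isElliptic D₀ rfl hopt₀

/-- **Per pair, `p ≥ 11`, off Edixhoven's exception: every optimal isogenous datum is admissible and
Conj. 1.10 there decides `BSD(W,p)`.** For `W` of class X4, `r_an = 0`, `ρ̄_{W,p}` onto, `p ≥ 11`,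
`¬ (TypeGOrd W p ∧ semistabilityIndex W p ≠ 2)`, and ANY `W₀ ∼ W` globally minimal with an optimal
conductor-level datum `D₀`: `p ∤ c(D₀)` and `BSD(W,p) ⟺ X4.KimTamagawaDefectAt W₀ p D₀.f`.
[cite: Kim2022StructureSelmer, Conj. 1.10 (PDF p. 8)] [cite: EdixhovenManin1991, Thm. 3]
[cite: Cassels1965ArithmeticVIII] [cite: Miller2011LMS, §1 and Def. 1.1] -/
theorem bsdp_iff_kimTamagawaDefectAt_optimal_of_not_exception
    (hKimk : Kim2026.rankZero_le_padicValNat_sha_of_kuriharaNumber_ne_zero)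
    (hE67c : Kim2026.rankZero_padicValNat_sha_add_le_of_forall_pow_dvd_kuriharaNumber_cyclicLevel)
    (hCassels : bsdRHS_eq_of_isIsogenous)
    (hGZK : rank_eq_analyticRank_of_analyticRank_le_one) (hmod : hasEntireLFunction_rat)
    (hEdx : edixhoven_not_dvd_maninConstant_of_not_potentiallyGoodOrdinary)
    (hEdxK : edixhoven_not_dvd_maninConstant_of_kodairaSymbol_ne)
    (hp7 : 7 < p) (hr : W.analyticRank = 0) (hX : ClassX4 W p) (hsurj : Surj W p)
    (hexc : ¬ (TypeGOrd W p ∧ semistabilityIndex W p ≠ 2))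
    {W₀ : WeierstrassCurve ℚ} [W₀.IsElliptic] [W₀.IsGloballyMinimal] (hiso : IsIsogenous W₀ W)
    {N₀ : ℕ} [NeZero N₀] (D₀ : ModularParametrizationData W₀ N₀) (hN₀ : W₀.conductorNorm ℤ = N₀)
    (hopt₀ : ∀ z ∈ D₀.L.lattice, ∃ w ∈ periodLattice D₀.f, z = D₀.c * w) :
    ¬ (p : ℤ) ∣ D₀.maninConstant ∧ (BSDp W p ↔ KimTamagawaDefectAt W₀ p D₀.f) := by
  have hc₀ := not_dvd_maninConstant_isogenous_optimal_of_not_exception hEdx hEdxK hp7 hX.2.1 hexc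
    hiso D₀ hN₀ hopt₀
  exact ⟨hc₀, bsdp_iff_kimTamagawaDefectAt_isogenous_optimal_of_kimFacts_of_five_le W W₀ p hKimk
    hE67c hCassels hGZK hmod (five_le_and_ne_two_of_seven_lt hp7).1 hr hX hsurj hiso D₀ hN₀ hopt₀ hc₀⟩

/-- **Existence form** (Modularity supplies the strong member): X4 ∧ `r_an = 0` ∧ surj ∧ `p ≥ 11`
off the exception ⟹ there IS an optimal isogenous `(W₀, D₀)` of the same conductor with `p ∤ c(D₀)`
and `BSD(W,p) ⟺ X4.KimTamagawaDefectAt W₀ p D₀.f` — Kim's Conjecture 1.10 at ONE computable datum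
is EXACTLY the `p`-part of BSD for the pair, with NO Manin clause left.
[cite: Kim2022StructureSelmer, Conj. 1.10 (PDF p. 8)] [cite: EdixhovenManin1991, Thm. 3]
[cite: BCDTJAMS2001, Thm. A] [cite: Cassels1965ArithmeticVIII] [cite: Miller2011LMS, Def. 1.1] -/
theorem exists_optimal_bsdp_iff_kimTamagawaDefectAt_of_not_exception
    (hKimk : Kim2026.rankZero_le_padicValNat_sha_of_kuriharaNumber_ne_zero)
    (hE67c : Kim2026.rankZero_padicValNat_sha_add_le_of_forall_pow_dvd_kuriharaNumber_cyclicLevel)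
    (hCassels : bsdRHS_eq_of_isIsogenous)
    (hGZK : rank_eq_analyticRank_of_analyticRank_le_one) (hnf : exists_isNewformOf)
    (hEdx : edixhoven_not_dvd_maninConstant_of_not_potentiallyGoodOrdinary)
    (hEdxK : edixhoven_not_dvd_maninConstant_of_kodairaSymbol_ne)
    (hp7 : 7 < p) (hr : W.analyticRank = 0) (hX : ClassX4 W p) (hsurj : Surj W p)
    (hexc : ¬ (TypeGOrd W p ∧ semistabilityIndex W p ≠ 2)) :
    ∃ (W₀ : WeierstrassCurve ℚ) (_ : W₀.IsElliptic) (_ : W₀.IsGloballyMinimal)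
      (_ : NeZero (W₀.conductorNorm ℤ)) (D₀ : ModularParametrizationData W₀ (W₀.conductorNorm ℤ)),
      IsIsogenous W₀ W ∧ W₀.conductorNorm ℤ = W.conductorNorm ℤ ∧
        (∀ z ∈ D₀.L.lattice, ∃ w ∈ periodLattice D₀.f, z = D₀.c * w) ∧
        ¬ (p : ℤ) ∣ D₀.maninConstant ∧ (BSDp W p ↔ KimTamagawaDefectAt W₀ p D₀.f) := by
  obtain ⟨W₀, hE₀, hM₀, hNz₀, D₀, hiso, hN, hopt₀, hc₀⟩ :=
    exists_isIsogenous_optimal_not_dvd_maninConstant_of_not_exception W p hnf hEdx hEdxK hp7 hX.2.1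
      hexc
  exact ⟨W₀, hE₀, hM₀, hNz₀, D₀, hiso, hN, hopt₀, hc₀,
    bsdp_iff_kimTamagawaDefectAt_isogenous_optimal_of_kimFacts_of_five_le W W₀ p hKimk hE67c hCassels
      hGZK (hasEntireLFunction_rat_of_exists_isNewformOf hnf) (five_le_and_ne_two_of_seven_lt hp7).1
      hr hX hsurj hiso D₀ rfl hopt₀ hc₀⟩

end Edixhoven

/-! ### §3 The X4 ∧ `r_an = 0` END STATE at `p ≥ 11`: MANIN♭ confined to (G-ord) ∩ defect `{3,4,6}` -/

/-- **X4 ∧ `r_an = 0` ∧ surj ∧ `p ≥ 11` END STATE** (inputs: Kim's two one-sided facts with their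
reading flags, Cassels, GZK, Modularity, Edixhoven 1991 Thm. 3 ×2 — nothing else):
"`MissingPPartAt` at EVERY such pair" ⟺ (i) Kim's Conjecture 1.10 at every OPTIMAL conductor-level
datum with `p ∤ c` (of such curves) ∧ (ii) `MissingPPartAt` on the EXCEPTION pairs — `TypeGOrd W p ∧
semistabilityIndex W p ≠ 2`, i.e. (G)-ordinary of defect `3, 4, 6` — NONE of whose isogenous strong
data has `p ∤ c`. Compared with GEN 17 (`…_optimal_of_kimFacts`, all `p ≥ 5`): the MANIN♭ residue is
now EMPTY on (M), on I₀* and on the potentially supersingular / (T′) rows, and carries no image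
clause. [cite: Kim2022StructureSelmer, Thm. 1.9 (6) and Conj. 1.10 (PDF p. 8)]
[cite: EdixhovenManin1991, Thm. 3] [cite: Cassels1965ArithmeticVIII] [cite: BCDTJAMS2001, Thm. A]
[cite: Miller2011LMS, §1 and Def. 1.1] -/
theorem x4RankZero_elevenLe_iff_kimTamagawaDefect_optimal_of_edixhoven
    (hKimk : Kim2026.rankZero_le_padicValNat_sha_of_kuriharaNumber_ne_zero)
    (hE67c : Kim2026.rankZero_padicValNat_sha_add_le_of_forall_pow_dvd_kuriharaNumber_cyclicLevel)
    (hCassels : bsdRHS_eq_of_isIsogenous)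
    (hGZK : rank_eq_analyticRank_of_analyticRank_le_one) (hnf : exists_isNewformOf)
    (hEdx : edixhoven_not_dvd_maninConstant_of_not_potentiallyGoodOrdinary)
    (hEdxK : edixhoven_not_dvd_maninConstant_of_kodairaSymbol_ne) :
    (∀ (W : WeierstrassCurve ℚ) [W.IsElliptic] [W.IsGloballyMinimal] (p : ℕ) [Fact p.Prime],
        7 < p → W.analyticRank = 0 → ClassX4 W p → Surj W p → MissingPPartAt W p) ↔
      (∀ (W : WeierstrassCurve ℚ) [W.IsElliptic] [W.IsGloballyMinimal] (p : ℕ) [Fact p.Prime],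
          7 < p → W.analyticRank = 0 → ClassX4 W p → Surj W p →
          ∀ {N : ℕ} [NeZero N] (D : ModularParametrizationData W N), W.conductorNorm ℤ = N →
          (∀ z ∈ D.L.lattice, ∃ w ∈ periodLattice D.f, z = D.c * w) → ¬ (p : ℤ) ∣ D.maninConstant →
          KimTamagawaDefectAt W p D.f) ∧
      (∀ (W : WeierstrassCurve ℚ) [W.IsElliptic] [W.IsGloballyMinimal] (p : ℕ) [Fact p.Prime],
          7 < p → W.analyticRank = 0 → ClassX4 W p → Surj W p →
          (TypeGOrd W p ∧ semistabilityIndex W p ≠ 2) →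
          (∀ (W₀ : WeierstrassCurve ℚ) [W₀.IsElliptic] [W₀.IsGloballyMinimal], IsIsogenous W₀ W →
            ∀ (N₀ : ℕ) [NeZero N₀] (D₀ : ModularParametrizationData W₀ N₀),
              W₀.conductorNorm ℤ ≠ N₀ ∨ (¬ ∀ z ∈ D₀.L.lattice, ∃ w ∈ periodLattice D₀.f, z = D₀.c * w) ∨
              (p : ℤ) ∣ D₀.maninConstant) →
          MissingPPartAt W p) := by
  have hmod : hasEntireLFunction_rat := hasEntireLFunction_rat_of_exists_isNewformOf hnf
  constructor
  · intro hX4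
    refine ⟨fun W _ _ p _ hp7 hr hX hs N _ D hN hopt hc ↦ ?_,
      fun W _ _ p _ hp7 hr hX hs _ _ ↦ hX4 W p hp7 hr hX hs⟩
    exact (missingPPartAt_iff_kimTamagawaDefectAt_of_optimal_of_kimFacts_of_five_le W p hKimk hE67c hGZK
      hmod (five_le_and_ne_two_of_seven_lt hp7).1 hr hs D hN hopt hc).mp (hX4 W p hp7 hr hX hs)
  · rintro ⟨hconj, hres⟩ W _ _ p _ hp7 hr hX hs
    have hp5 : 5 ≤ p := (five_le_and_ne_two_of_seven_lt hp7).1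
    have hr1 : W.analyticRank ≤ 1 := by rw [hr]; exact zero_le_one
    haveI : Finite W.sha := (hGZK W hr1).2
    by_cases hD : ∃ (W₀ : WeierstrassCurve ℚ) (_ : W₀.IsElliptic) (_ : W₀.IsGloballyMinimal),
        IsIsogenous W₀ W ∧
        ∃ (N₀ : ℕ) (_ : NeZero N₀) (D₀ : ModularParametrizationData W₀ N₀),
          W₀.conductorNorm ℤ = N₀ ∧ (∀ z ∈ D₀.L.lattice, ∃ w ∈ periodLattice D₀.f, z = D₀.c * w) ∧
          ¬ (p : ℤ) ∣ D₀.maninConstant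
    · -- a strong isogenous datum prime to `p`: Conj. 1.10 there ⟹ BSD(W₀,p) ⟹ BSD(W,p) (Cassels)
      obtain ⟨W₀, _, _, hiso, N₀, _, D₀, hN₀, hopt₀, hc₀⟩ := hD
      have hXs₀ := (GaloisImage.classX4_and_surj_iff_of_isIsogenous (p := p) hiso).mpr ⟨hX, hs⟩
      have hr₀ : W₀.analyticRank = 0 := by rw [analyticRank_eq_of_isIsogenous' hiso, hr]
      exact (missingPPartAt_iff_kimTamagawaDefectAt_isogenous_optimal_of_kimFacts_of_five_le W W₀ p
        hKimk hE67c hCassels hGZK hmod hp5 hr hX hs hiso D₀ hN₀ hopt₀ hc₀).mpr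
        (hconj W₀ p hp7 hr₀ hXs₀.1 hXs₀.2 D₀ hN₀ hopt₀ hc₀)
    · -- no such datum: the strong member (Modularity) has `p ∣ c`, so `W` is on the exception
      have hnone : ∀ (W₀ : WeierstrassCurve ℚ) [W₀.IsElliptic] [W₀.IsGloballyMinimal],
          IsIsogenous W₀ W → ∀ (N₀ : ℕ) [NeZero N₀] (D₀ : ModularParametrizationData W₀ N₀),
            W₀.conductorNorm ℤ ≠ N₀ ∨
              (¬ ∀ z ∈ D₀.L.lattice, ∃ w ∈ periodLattice D₀.f, z = D₀.c * w) ∨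
              (p : ℤ) ∣ D₀.maninConstant := by
        intro W₀ _ _ hiso N₀ _ D₀
        by_contra hnot
        simp only [not_or, not_not] at hnot
        exact hD ⟨W₀, inferInstance, inferInstance, hiso, N₀, inferInstance, D₀, hnot.1, hnot.2.1,
          hnot.2.2⟩
      have hexc : TypeGOrd W p ∧ semistabilityIndex W p ≠ 2 := by
        by_contra hexc
        obtain ⟨W₀, hE₀, hM₀, hNz₀, D₀, hiso, -, hopt₀, hc₀⟩ :=
          exists_isIsogenous_optimal_not_dvd_maninConstant_of_not_exception W p hnf hEdx hEdxK hp7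
            hX.2.1 hexc
        rcases hnone W₀ hiso (W₀.conductorNorm ℤ) D₀ with h | h | h
        · exact h rfl
        · exact h hopt₀
        · exact hc₀ h
      exact hres W p hp7 hr hX hs hexc hnone

end Summit.BirchSwinnertonDyer.Rank1Residual.X4

end
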